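import Literature.AlgebraicGeometry.HodgeTheory.GriffithsResiduesPoleOrderOne
import Literature.AlgebraicGeometry.Motives.HodgeStructureAutomorphismPicardNumber
import HarnessLib

/-!
# Griffiths' residues at pole order one: the geometric genus bound `p_g(X_F) ≥ dim S^{d−n−2}`, and the
# EXACT equivariant count of `H^{n,0}` granted the reverse bound

Family `hodge`, layer `Literature/AlgebraicGeometry/HodgeTheory`. PROOF FILE (theorems only; no
definition, no named fact — D-0026), sequel of `GriffithsResiduesPoleOrderOne`
(`exists_residueMap_poleOrderOne`: the equivariant injection `res₁ : S^{d−n−2} ↪ H^{n,0}(X_F)` for a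
nonsingular form `F` of degree `d ≥ n + 2` in `n + 2 ≥ 3` variables). In the vocabulary of the tree's Hodge
structure `BettiUniverse.hodge hHD hX n` on `Hⁿ(X_F(ℂ); ℚ)` and the twisted action
`T_a P = (∏ aᵢ) P(a • x)` of a diagonal symmetry `a` on `ℂ[x₀, …, x_{n+1}]`:

* `finrank_homogeneousSubmodule_le_finrank_piece` — **`dim S^{d−n−2} ≤ h^{n,0}(X_F)`**, i.e.
  `p_g(X_F) ≥ C(d−1, n+1)` (Voisin II Cor. 6.12 at `p = 1`, the injectivity half);
* `finrank_eigenspace_inf_piece_eq_of_finrank_piece_le` — **granted the reverse inequality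
  `h^{n,0}(X_F) ≤ dim S^{d−n−2}`** (every holomorphic `n`-form is a residue: adjunction
  `K_{X_F} = 𝒪(d−n−2)` with Serre's GAGA, Hartshorne II Ex. 8.20.3 / Voisin II Cor. 6.12 at `p = 1` — NOT
  proved in the tree and taken here as an explicit numerical hypothesis), the residues exhaust `H^{n,0}` and
  **`dim_ℂ (E_μ(σ_a^* ⊗ ℂ) ∩ H^{n,0}(X_F)) = dim_ℂ (S^{d−n−2})_μ` for every `μ`** (the eigen-geometric-genus of a
  diagonal symmetry is the number of monomials `x^e` of degree `d − n − 2` with `∏ aᵢ^{eᵢ+1} = μ`; Shioda 1979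
  §1 (1.7) for the Fermat varieties, Carlson–Toledo 1999 §5 at `q = 0` for cyclic covers);
* `finrank_eigenspace_inf_piece_zero_top_eq` — **Hodge symmetry for eigenspaces**:
  `dim (E_α ∩ H^{0,n}) = dim (E_ᾱ ∩ H^{n,0})` for the rational automorphism `σ_a^*` (complex conjugation;
  Shioda 1981 §2, proof of Lemma 2.1: "`H^{0,2}` is the complex conjugate of `H^{2,0}`").

## References

* [VoisinHodgeII2003] C. Voisin, Hodge Theory and Complex Algebraic Geometry II (2003), §6.1.3 Cor. 6.12.
* [Shioda1979HodgeFermat] T. Shioda, The Hodge conjecture for Fermat varieties, Math. Ann. 245 (1979), §1 (1.7).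
* [Shioda1981PicardNumber] T. Shioda, On the Picard number of a complex projective variety, Ann. Sci. ÉNS
  14 (1981), §2 Lemma 2.1.
* [CarlsonToledo1999] J. Carlson, D. Toledo, Discriminant complements and kernels of monodromy
  representations, Duke Math. J. 97 (1999), §5.
* [Hartshorne1977] R. Hartshorne, Algebraic Geometry (1977), II Example 8.20.3.
-/

noncomputable section

open scoped TensorProduct
open CategoryTheory AlgebraicGeometry MvPolynomial

namespace Literature.AlgebraicGeometry.HodgeTheory

open Literature.AlgebraicGeometry.Motives Literature.AlgebraicTopology.SingularHomology

variable {n : ℕ} {F : MvPolynomial (Fin (n + 2)) ℂ}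

/-- **`p_g(X_F) ≥ dim S^{d−n−2} = C(d−1, n+1)`** for a nonsingular form `F` of degree `d ≥ n + 2` in
`n + 2 ≥ 3` variables with `X_F` smooth projective of dimension `n`: the residues `Res(PΩ/F)`,
`deg P = d − n − 2`, give `dim S^{d−n−2}` independent classes in `H^{n,0}(X_F)`
(`exists_residueMap_poleOrderOne`). In print (Voisin II Cor. 6.12 at `p = 1`):
`S^{d−n−2} = R_F^{d−n−2} ≅ H^{n,0}(X_F)` — here the injectivity half.
[cite: VoisinHodgeII2003, §6.1.3 Cor. 6.12 (p = 1)] -/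
theorem finrank_homogeneousSubmodule_le_finrank_piece (hHD : exists_isReal_hodgeModel)
    (hn : 1 ≤ n) {d : ℕ} (hd : n + 2 ≤ d) (hF : F.IsHomogeneous d)
    (hJ : SmoothHypersurface.IsNonsingularForm ℂ F)
    (hX : IsSmoothProjective n (SmoothHypersurface.hypersurface F)) :
    Module.finrank ℂ ↥(homogeneousSubmodule (Fin (n + 2)) ℂ (d - (n + 2))) ≤
      Module.finrank ℂ ↥((BettiUniverse.hodge hHD hX n).piece (n : ℤ) 0) := by
  classical
  set X := SmoothHypersurface.hypersurface F with hXdef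
  set A := BettiUniverse.realHodgeModel hHD hX with hAdef
  set H := BettiUniverse.hodge hHD hX n with hHdef
  set Sk := homogeneousSubmodule (Fin (n + 2)) ℂ (d - (n + 2)) with hSk
  obtain ⟨res, h1, -, h4⟩ := exists_residueMap_poleOrderOne hn hd hF hJ hX A
  set β := ofRatClassBaseChangeEquiv hX n with hβ
  set ρ : MvPolynomial (Fin (n + 2)) ℂ →ₗ[ℂ] ℂ ⊗[ℚ] ↥(bettiCohomology X n) :=
    β.symm.toLinearMap ∘ₗ res with hρ
  haveI : Module.Finite ℚ ↥(bettiCohomology X n) := BettiUniverse.finite hX n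
  haveI : Module.Finite ℂ ↥Sk := Module.Finite.iff_fg.mpr (homogeneousSubmodule_fg (Fin (n + 2)) ℂ _)
  have hβρ : ∀ P, β (ρ P) = res P := fun P ↦ by
    rw [hρ, LinearMap.comp_apply, LinearEquiv.coe_toLinearMap, LinearEquiv.apply_symm_apply]
  have hpiece : ∀ P, ρ P ∈ H.piece (n : ℤ) 0 := by
    intro P
    have hp : H.piece (n : ℤ) 0 = A.ratPiece hX n n 0 := by
      have h := A.piece_eq_ratPiece hX (BettiUniverse.realHodgeModel_isHodgeSymmetric hHD hX)
        (show n + 0 = n from rfl)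
      rw [Nat.cast_zero] at h
      exact h
    rw [hp, HodgeModel.mem_ratPiece_iff, HodgeModel.complexification_apply]
    change A.pullback n (β (ρ P)) ∈ A.hodgePQ n n 0
    rw [hβρ]
    exact h1 P
  have hmaple : Sk.map ρ ≤ H.piece (n : ℤ) 0 := by
    rintro _ ⟨P, -, rfl⟩
    exact hpiece P
  have hker : Sk ⊓ LinearMap.ker ρ = ⊥ := by
    refine eq_bot_iff.mpr ?_
    rintro P ⟨hP, hPker⟩
    rw [Submodule.mem_bot]
    refine h4 P ((mem_homogeneousSubmodule _ P).mp hP) ?_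
    have h0 : ρ P = 0 := LinearMap.mem_ker.mp hPker
    rw [← hβρ, h0, map_zero]
  have hrank := finrank_map_add_finrank_inf_ker ρ Sk
  rw [hker, finrank_bot, add_zero] at hrank
  rw [← hrank]
  exact Submodule.finrank_mono hmaple

/-- **Granted `h^{n,0}(X_F) ≤ dim S^{d−n−2}`, the residues exhaust `H^{n,0}` and the eigen-geometric-genus
of a diagonal symmetry is the monomial count**: for `F`, `X_F`, `a ∈ diagonalStabilizer F` as in
`exists_residueMap_poleOrderOne` and every `μ ∈ ℂ`,
`dim_ℂ (E_μ(σ_a^* ⊗ ℂ) ∩ H^{n,0}(X_F)) = dim_ℂ (S^{d−n−2})_μ`, the `μ`-eigenspace of the twisted action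
`T_a P = (∏ aᵢ) P(a • x)` on the forms of degree `d − n − 2`. Proof: `ρ = β⁻¹ ∘ res₁` maps `S^{d−n−2}`
injectively into `H^{n,0}`, hence ONTO by the dimension hypothesis; an `μ`-eigenvector `x = ρ(P)` is
`ρ(P_μ)` for the `μ`-eigencomponent `P_μ` of `P` (`ρ` intertwines `T_a` and `σ_a^* ⊗ ℂ`, and eigenvectors
for distinct eigenvalues are independent). In print: Voisin II Cor. 6.12 at `p = 1` read equivariantly
(Shioda 1979 §1 (1.7): `H^{n,0}(Xⁿ_m) ∩ V(α)` is spanned by the residues of the monomials of character `α`;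
Carlson–Toledo 1999 §5, `q = 0`). The hypothesis is the surjectivity half of Cor. 6.12 (`K = 𝒪(d−n−2)`,
Serre GAGA), not proved in the tree. [cite: VoisinHodgeII2003, §6.1.3 Cor. 6.12 (p = 1)]
[cite: Shioda1979HodgeFermat, §1 (1.7)] [cite: CarlsonToledo1999, §5] -/
theorem finrank_eigenspace_inf_piece_eq_of_finrank_piece_le (hHD : exists_isReal_hodgeModel)
    (hn : 1 ≤ n) {d : ℕ} (hd : n + 2 ≤ d) (hF : F.IsHomogeneous d)
    (hJ : SmoothHypersurface.IsNonsingularForm ℂ F)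
    (hX : IsSmoothProjective n (SmoothHypersurface.hypersurface F))
    (hpg : Module.finrank ℂ ↥((BettiUniverse.hodge hHD hX n).piece (n : ℤ) 0) ≤
      Module.finrank ℂ ↥(homogeneousSubmodule (Fin (n + 2)) ℂ (d - (n + 2))))
    {a : Fin (n + 2) → ℂˣ} (ha : a ∈ diagonalStabilizer F) (μ : ℂ) :
    Module.finrank ℂ ↥(Module.End.eigenspace ((BettiUniverse.pull (diagonalAut F ha) n).baseChange ℂ) μ ⊓
        (BettiUniverse.hodge hHD hX n).piece (n : ℤ) 0) =
      Module.finrank ℂ ↥(Module.End.eigenspace (twistedDiagonalAction a) μ ⊓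
        homogeneousSubmodule (Fin (n + 2)) ℂ (d - (n + 2))) := by
  classical
  set X := SmoothHypersurface.hypersurface F with hXdef
  set A := BettiUniverse.realHodgeModel hHD hX with hAdef
  set H := BettiUniverse.hodge hHD hX n with hHdef
  set gC := (BettiUniverse.pull (diagonalAut F ha) n).baseChange ℂ with hgC
  set T := twistedDiagonalAction a with hTdef
  set Sk := homogeneousSubmodule (Fin (n + 2)) ℂ (d - (n + 2)) with hSk
  obtain ⟨res, h1, h3, h4⟩ := exists_residueMap_poleOrderOne hn hd hF hJ hX A
  set β := ofRatClassBaseChangeEquiv hX n with hβ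
  set ρ : MvPolynomial (Fin (n + 2)) ℂ →ₗ[ℂ] ℂ ⊗[ℚ] ↥(bettiCohomology X n) :=
    β.symm.toLinearMap ∘ₗ res with hρ
  haveI : Module.Finite ℚ ↥(bettiCohomology X n) := BettiUniverse.finite hX n
  haveI : Module.Finite ℂ ↥Sk := Module.Finite.iff_fg.mpr (homogeneousSubmodule_fg (Fin (n + 2)) ℂ _)
  have hβρ : ∀ P, β (ρ P) = res P := fun P ↦ by
    rw [hρ, LinearMap.comp_apply, LinearEquiv.coe_toLinearMap, LinearEquiv.apply_symm_apply]
  have hpiece : ∀ P, ρ P ∈ H.piece (n : ℤ) 0 := by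
    intro P
    have hp : H.piece (n : ℤ) 0 = A.ratPiece hX n n 0 := by
      have h := A.piece_eq_ratPiece hX (BettiUniverse.realHodgeModel_isHodgeSymmetric hHD hX)
        (show n + 0 = n from rfl)
      rw [Nat.cast_zero] at h
      exact h
    rw [hp, HodgeModel.mem_ratPiece_iff, HodgeModel.complexification_apply]
    change A.pullback n (β (ρ P)) ∈ A.hodgePQ n n 0
    rw [hβρ]
    exact h1 P
  -- equivariance
  have hβg : ∀ y, β (gC y) = complexBetti.map (diagonalAut F ha) n (β y) := fun y ↦
    HodgeModel.ofRatClassBaseChange_baseChange_map (diagonalAut F ha) n y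
  have hequiv : ∀ P ∈ Sk, gC (ρ P) = ρ (T P) := by
    intro P hP
    apply β.injective
    rw [hβg, hβρ, hβρ, hTdef, twistedDiagonalAction_apply, map_smul]
    exact h3 a ha P ((mem_homogeneousSubmodule _ P).mp hP)
  have heig : ∀ (ν : ℂ) (P : MvPolynomial (Fin (n + 2)) ℂ), P ∈ Module.End.eigenspace T ν → P ∈ Sk →
      ρ P ∈ Module.End.eigenspace gC ν := by
    intro ν P hPν hP
    rw [Module.End.mem_eigenspace_iff, hequiv P hP, Module.End.mem_eigenspace_iff.mp hPν, map_smul]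
  -- `ρ` is injective on `S^k` and onto `H^{n,0}`
  have hker : Sk ⊓ LinearMap.ker ρ = ⊥ := by
    refine eq_bot_iff.mpr ?_
    rintro P ⟨hP, hPker⟩
    rw [Submodule.mem_bot]
    refine h4 P ((mem_homogeneousSubmodule _ P).mp hP) ?_
    have h0 : ρ P = 0 := LinearMap.mem_ker.mp hPker
    rw [← hβρ, h0, map_zero]
  have hrank := finrank_map_add_finrank_inf_ker ρ Sk
  rw [hker, finrank_bot, add_zero] at hrank
  have hsurj : Sk.map ρ = H.piece (n : ℤ) 0 :=
    Submodule.eq_of_le_of_finrank_le (by rintro _ ⟨P, -, rfl⟩; exact hpiece P) (by rw [hrank]; exact hpg)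
  -- (X1) `E_μ ∩ H^{n,0} = ρ((S^k)_μ)`
  set Sμ := Module.End.eigenspace T μ ⊓ Sk with hSμ
  haveI : FiniteDimensional ℂ ↥Sμ := Submodule.finiteDimensional_inf_right _ _
  have X1 : Module.End.eigenspace gC μ ⊓ H.piece (n : ℤ) 0 = Sμ.map ρ := by
    refine le_antisymm ?_ ?_
    · rintro x ⟨hxE, hxF⟩
      rw [← hsurj] at hxF
      obtain ⟨P, hP, rfl⟩ := Submodule.mem_map.mp hxF
      set s := P.support.image (diagonalCharacter a) with hs
      have hsum : ρ P = ∑ ν ∈ s, ρ (eigenComponent a ν P) := by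
        conv_lhs => rw [← sum_eigenComponent a P]
        rw [map_sum]
      have hterms : ∀ ν ∈ s, ρ (eigenComponent a ν P) ∈ Module.End.eigenspace gC ν := fun ν _ ↦
        heig ν _ (eigenComponent_mem_eigenspace a ν P) (eigenComponent_mem_homogeneousSubmodule a ν hP)
      have hxE' : ∑ ν ∈ s, ρ (eigenComponent a ν P) ∈ Module.End.eigenspace gC μ := hsum ▸ hxE
      have key := sum_eq_of_sum_mem_eigenspace gC s (fun ν ↦ ρ (eigenComponent a ν P)) hterms hxE'
      rw [← hsum] at key
      rw [key]
      split_ifs with hμs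
      · exact Submodule.mem_map_of_mem
          ⟨eigenComponent_mem_eigenspace a μ P, eigenComponent_mem_homogeneousSubmodule a μ hP⟩
      · exact Submodule.zero_mem _
    · rintro _ ⟨P, ⟨hPμ, hP⟩, rfl⟩
      exact ⟨heig μ P hPμ hP, hpiece P⟩
  have hkerμ : Sμ ⊓ LinearMap.ker ρ = ⊥ :=
    le_bot_iff.mp (le_trans (inf_le_inf_right _ inf_le_right) hker.le)
  have hrankμ := finrank_map_add_finrank_inf_ker ρ Sμ
  rw [hkerμ, finrank_bot, add_zero] at hrankμ
  rw [X1, hrankμ]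

/-- **Hodge symmetry for the eigenspaces of a rational automorphism: `dim (E_α ∩ H^{0,k}) = dim (E_ᾱ ∩ H^{k,0})`.**
For `X` smooth projective, a self-map `σ : X ⟶ X`, the degree `k` and any `α ∈ ℂ`, complex conjugation on
`ℂ ⊗_ℚ Hᵏ(X(ℂ); ℚ)` maps the `α`-eigenspace of `σ^* ⊗ ℂ` onto the `ᾱ`-eigenspace (σ^* is rational) and
`H^{0,k} = conj H^{k,0}`; it is conjugate-linear and bijective, so the dimensions agree (Shioda 1981, proof
of Lemma 2.1: "Recall that `H^{0,2}` is the complex conjugate of `H^{2,0}`. By looking at the eigenspaces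
with eigenvalue `α` …"; the tree's `HodgeStructure.Hom.finrank_eigenspace_inf_complexConj_F` with
`H^{k,0} = Fᵏ`, `H^{0,k} = conj Fᵏ`). [cite: Shioda1981PicardNumber, §2 Lemma 2.1 (proof)] -/
theorem finrank_eigenspace_inf_piece_zero_top_eq (hHD : exists_isReal_hodgeModel)
    (hI : hodgePQ_independent_of_hodgeModel) {m : ℕ} {X : Motives.SchemeOver ℂ}
    (hX : IsSmoothProjective m X) (σ : X ⟶ X) (k : ℕ) (α : ℂ) :
    Module.finrank ℂ ↥(Module.End.eigenspace ((BettiUniverse.pull σ k).baseChange ℂ) α ⊓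
        (BettiUniverse.hodge hHD hX k).piece 0 (k : ℤ)) =
      Module.finrank ℂ ↥(Module.End.eigenspace ((BettiUniverse.pull σ k).baseChange ℂ) (starRingEnd ℂ α) ⊓
        (BettiUniverse.hodge hHD hX k).piece (k : ℤ) 0) := by
  haveI : Module.Finite ℚ ↥(bettiCohomology X k) := BettiUniverse.finite hX k
  set H := BettiUniverse.hodge hHD hX k with hHdef
  set g := BettiUniverse.pullHodgeHom hHD hI hX hX σ k with hgdef
  have hg : g.toLinearMap.baseChange ℂ = (BettiUniverse.pull σ k).baseChange ℂ := by
    rw [hgdef, BettiUniverse.pullHodgeHom_toLinearMap]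
  have hF0 : H.F 0 = ⊤ := by
    rw [hHdef, BettiUniverse.hodge_F]
    exact HodgeModel.ratF_of_nonpos _ hX k le_rfl
  have h0k : H.piece 0 (k : ℤ) = Motives.HodgeStructure.complexConj (H.F (k : ℤ)) := by
    rw [Motives.HodgeStructure.piece_of_add_eq H (by simp), hF0, top_inf_eq]
  have hk0 : H.piece (k : ℤ) 0 = H.F (k : ℤ) := by
    rw [Motives.HodgeStructure.piece_of_add_eq H (by simp), hF0, Motives.HodgeStructure.complexConj_top,
      inf_top_eq]
  rw [h0k, hk0, ← hg, Motives.HodgeStructure.Hom.finrank_eigenspace_inf_complexConj_F g (k : ℤ) α]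
  rfl

end Literature.AlgebraicGeometry.HodgeTheory

end
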